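import Mathlib
import Summits.ValiantsHypothesis.ValiantsHypothesis.Theorems.RigidityForcesSymmetryRankRigidMinimalReprLaplaceFiveSeparatedCaptureReduction
import Summits.ValiantsHypothesis.ValiantsHypothesis.Theorems.RigidityForcesSymmetryRankRigidMinimalReprLaplaceFiveSeparatedCaptureProlongation
import Summits.ValiantsHypothesis.ValiantsHypothesis.Theorems.RigidityForcesSymmetryRankRigidMinimalReprLaplaceFiveSeparatedCaptureTwoCuts

/-!
# ValiantsHypothesis / RigidityForcesSymmetry — crux `LaplaceOptimalFive` (stmt-ValiantsHypothesis-24813), symmetric capture: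
# ★★ **TWO DISJOINT SPANS AND A PLANE: `finrank W ≤ finrank (U₀₁ ⊔ U₀₂)⁽¹⁾`** (profiles `(r₁, r₂, ≤ 2)` with `U₀₁ ∩ U₀₂ = 0`)

(val-port-2 g5 ↔ crit-3 g8, 2026-08-29.)  Let `U₀₁, U₀₂` be symmetric spans with `U₀₁ ⊓ U₀₂ = ⊥` and `U₁₂` symmetric with
`finrank U₁₂ ≤ 2`.  By ✓ `finrank_le_of_pairs_mem` (brick R1) `finrank W ≤ finrank AB` for any `AB` containing the placed pair parts
`(A, B)` of the obligations; by ✓ `pairPart_pencil` the combination `S(p,q,r) := A_r(p,q) − B_r(p,q)` is a FULLY SYMMETRIC tensor with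
slices `A_p − B_p ∈ U₀₁ ⊔ U₀₂`, i.e. `S ∈ prolong (U₀₁ ⊔ U₀₂)` (✓ `…SeparatedCaptureProlongation`, val-lit-p6 g18), and `(A, B) ↦ S` is
injective as soon as `U₀₁ ∩ U₀₂ = 0`.  Hence `finrank W ≤ finrank (U₀₁ ⊔ U₀₂)⁽¹⁾`, and with the prolongation bounds
(`1 ↦ 1, 2 ↦ 2, 3 ↦ 4`) the capture inequality follows for `finrank U₀₁ + finrank U₀₂ ≤ 3`: profiles `(1,1,≤2)` with distinct lines
(again), `(1,2,≤2)` / `(2,1,≤2)` with the line NOT inside the plane, `(0,k,≤2)`, `k ≤ 3`.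

* ★★ `finrank_le_prolong_of_disjoint` — `finrank W ≤ finrank (prolong (U₀₁ ⊔ U₀₂))`.
* ★★ `captureIneqSym_of_disjoint_pair` — `finrank U₀₁ + finrank U₀₂ ≤ 3` ⇒ `finrank W ≤ finrank U₀₁ + finrank U₀₂ + finrank U₁₂`.

Reach.  `finrank_le_prolong_of_disjoint` is profile-free in `(finrank U₀₁, finrank U₀₂)`: together with ANY growth bound
`finrank X⁽¹⁾ ≤ finrank X + c` it extends the capture inequality to every disjoint-pair profile with `c ≤ finrank U₁₂` (`U₁₂ = ⊥` being
✓ `captureIneqSym_of_third_bot`); beyond `finrank X = 3` this needs Macaulay's bound (`h₂ = 4 ⇒ h₃ ≤ 5`, Bruns–Herzog 4.2.10), not in the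
tree.  In the corollary the case `finrank U₁₂ = 0` is dispatched to ✓ `captureIneqSym_of_third_bot` (no extra hypothesis).

Honest framing.  Profiles with `U₀₁ ∩ U₀₂ ≠ 0` beyond two lines (e.g. `(1,2,2)` with the line inside the plane), `(2,2,2)`, anything with
two spans of dimension `≥ 3`, `CaptureIneqSym` in general, K1 on `K₃ ⊔ K₂`, `LaplaceOptimalFive` (OPEN · CONTESTED 72/120) and `VP ≠ VNP`
are NOT proved here.  No definitions, no `sorry`.
-/

set_option linter.dupNamespace false
set_option autoImplicit false

namespace Summit.ValiantsHypothesis.ValiantsHypothesis.Theorems.RigidityForcesSymmetryRankRigidMinimalRepr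

namespace LaplaceFiveSeparatedCapture

open Finset

/-- ★★ **TWO DISJOINT SPANS AND A PLANE.**  `U₀₁ ⊓ U₀₂ = ⊥` (both symmetric), `U₁₂` symmetric with `finrank U₁₂ ≤ 2`, `W` symmetric
zero-diagonal captured by `L3 U₀₁ U₀₂ U₁₂` ⇒ `finrank W ≤ finrank (prolong (U₀₁ ⊔ U₀₂))`. [folklore] -/
theorem finrank_le_prolong_of_disjoint (U01 U02 U12 W : Submodule ℂ (Fin 5 → Fin 5 → ℂ))
    (h01 : ∀ x ∈ U01, ∀ p q : Fin 5, x p q = x q p) (h02 : ∀ x ∈ U02, ∀ p q : Fin 5, x p q = x q p)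
    (h12 : ∀ x ∈ U12, ∀ p q : Fin 5, x p q = x q p) (hdis : U01 ⊓ U02 = ⊥) (hd : Module.finrank ℂ U12 ≤ 2)
    (hWs : ∀ μ ∈ W, ∀ s t : Fin 5, μ s t = μ t s) (hWd : ∀ μ ∈ W, ∀ s : Fin 5, μ s s = 0)
    (hWc : ∀ μ ∈ W, contractZ μ ∈ L3 U01 U02 U12) :
    Module.finrank ℂ W ≤ Module.finrank ℂ (prolong (U01 ⊔ U02)) := by
  classical
  -- slices and the slot swap as linear maps
  let sL : Fin 5 → ((Fin 5 → Fin 5 → Fin 5 → ℂ) →ₗ[ℂ] (Fin 5 → Fin 5 → ℂ)) := fun r =>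
    { toFun := fun A p q => A p q r, map_add' := fun _ _ => rfl, map_smul' := fun _ _ => rfl }
  let sM : Fin 5 → ((Fin 5 → Fin 5 → Fin 5 → ℂ) →ₗ[ℂ] (Fin 5 → Fin 5 → ℂ)) := fun q =>
    { toFun := fun B p r => B p q r, map_add' := fun _ _ => rfl, map_smul' := fun _ _ => rfl }
  let sw : (Fin 5 → Fin 5 → Fin 5 → ℂ) →ₗ[ℂ] (Fin 5 → Fin 5 → Fin 5 → ℂ) :=
    { toFun := fun B p q r => B p r q, map_add' := fun _ _ => rfl, map_smul' := fun _ _ => rfl }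
  let Ψ : ((Fin 5 → Fin 5 → Fin 5 → ℂ) × (Fin 5 → Fin 5 → Fin 5 → ℂ)) →ₗ[ℂ] (Fin 5 → Fin 5 → Fin 5 → ℂ) :=
    LinearMap.fst ℂ _ _ - sw.comp (LinearMap.snd ℂ _ _)
  have hΨ : ∀ (x : (Fin 5 → Fin 5 → Fin 5 → ℂ) × (Fin 5 → Fin 5 → Fin 5 → ℂ)) p q r,
      Ψ x p q r = x.1 p q r - x.2 p r q := fun x p q r => rfl
  let X : Submodule ℂ (Fin 5 → Fin 5 → ℂ) := U01 ⊔ U02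
  let AB : Submodule ℂ ((Fin 5 → Fin 5 → Fin 5 → ℂ) × (Fin 5 → Fin 5 → Fin 5 → ℂ)) :=
    ((⨅ r, U01.comap (sL r)).comap (LinearMap.fst ℂ _ _) ⊓ (⨅ q, U02.comap (sM q)).comap (LinearMap.snd ℂ _ _))
      ⊓ (prolong X).comap Ψ
  have hAB : ∀ x : (Fin 5 → Fin 5 → Fin 5 → ℂ) × (Fin 5 → Fin 5 → Fin 5 → ℂ), x ∈ AB ↔
      ((∀ r, (fun p q => x.1 p q r) ∈ U01) ∧ (∀ q, (fun p r => x.2 p q r) ∈ U02)) ∧ Ψ x ∈ prolong X := by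
    intro x
    simp only [AB, Submodule.mem_inf, Submodule.mem_comap, Submodule.mem_iInf, LinearMap.fst_apply, LinearMap.snd_apply]
    exact Iff.rfl
  -- `Ψ` is injective on `AB`
  have hinj : Function.Injective (Ψ.domRestrict AB) := by
    rw [injective_iff_map_eq_zero]
    intro x hx
    rw [LinearMap.domRestrict_apply] at hx
    obtain ⟨⟨hA, hB⟩, -⟩ := (hAB x.1).mp x.2
    have hsl : ∀ r, (fun p q => x.1.1 p q r) = (fun p q => x.1.2 p r q) := fun r => by
      funext p q
      have := congrFun (congrFun (congrFun hx p) q) r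
      rw [hΨ, Pi.zero_apply, Pi.zero_apply, Pi.zero_apply, sub_eq_zero] at this
      exact this
    have hz : ∀ r, (fun p q => x.1.1 p q r) = 0 := fun r => by
      have hmem : (fun p q => x.1.1 p q r) ∈ U01 ⊓ U02 := Submodule.mem_inf.mpr ⟨hA r, by rw [hsl r]; exact hB r⟩
      rw [hdis] at hmem
      exact (Submodule.mem_bot ℂ).mp hmem
    apply Subtype.ext
    refine Prod.ext ?_ ?_
    · funext p q r
      have := congrFun (congrFun (hz r) p) q
      simpa using this
    · funext p q r
      have h1 : x.1.1 p r q = 0 := by simpa using congrFun (congrFun (hz q) p) r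
      have h2 : x.1.1 p r q = x.1.2 p q r := congrFun (congrFun (hsl q) p) r
      show x.1.2 p q r = 0
      rw [← h2, h1]
  have hfin : Module.finrank ℂ AB ≤ Module.finrank ℂ (prolong X) := by
    have e := LinearMap.finrank_range_of_inj hinj
    rw [LinearMap.range_domRestrict] at e
    rw [← e]
    exact Submodule.finrank_mono (Submodule.map_le_iff_le_comap.mpr inf_le_right)
  -- feed R1
  refine (finrank_le_of_pairs_mem U01 U02 U12 W h12 hd hWs hWd hWc AB fun μ hμ A B C hA hB hC hT => ?_).trans hfin
  refine (hAB _).mpr ⟨⟨fun r => hA r, fun q => hB q⟩, ?_⟩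
  -- the pair combination `S(p,q,r) = A_r(p,q) − B_r(p,q)` is fully symmetric with slices `A_p − B_p`
  have hpen := pairPart_pencil U12 h12 μ A B C hC hT
  have hS12 : ∀ p q r, A r p q - B r p q = A r q p - B r q p := fun p q r => by
    rw [h01 _ (hA r) p q, h02 _ (hB r) p q]
  have hS23 : ∀ p q r, A r p q - B r p q = A q p r - B q p r := fun p q r => by
    have := hpen p q r; linear_combination this
  have hS13 : ∀ p q r, A r p q - B r p q = A p q r - B p q r := fun p q r => by
    rw [hS12 p q r, hS23 q p r]
  rw [mem_prolong_iff]
  refine ⟨fun p q r => ?_, fun p q r => ?_, fun p => ?_⟩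
  · show A r p q - B r p q = A r q p - B r q p
    exact hS12 p q r
  · show A r p q - B r p q = A q p r - B q p r
    exact hS23 p q r
  · have hfun : (Ψ ((fun p q r => A r p q), (fun p q r => B q p r))) p = A p - B p := by
      funext q r
      show A r p q - B r p q = (A p - B p) q r
      rw [Pi.sub_apply, Pi.sub_apply]; exact hS13 p q r
    rw [hfun]
    exact Submodule.sub_mem _ (Submodule.mem_sup_left (hA p)) (Submodule.mem_sup_right (hB p))

/-- ★★ **`CaptureIneqSym` FOR TWO DISJOINT SPANS OF TOTAL DIMENSION ≤ 3 AND A SPAN OF DIMENSION ≤ 2.** [folklore] -/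
theorem captureIneqSym_of_disjoint_pair (U01 U02 U12 W : Submodule ℂ (Fin 5 → Fin 5 → ℂ))
    (h01 : ∀ x ∈ U01, ∀ p q : Fin 5, x p q = x q p) (h02 : ∀ x ∈ U02, ∀ p q : Fin 5, x p q = x q p)
    (h12 : ∀ x ∈ U12, ∀ p q : Fin 5, x p q = x q p) (hdis : U01 ⊓ U02 = ⊥)
    (h3 : Module.finrank ℂ U01 + Module.finrank ℂ U02 ≤ 3) (hd : Module.finrank ℂ U12 ≤ 2)
    (hWs : ∀ μ ∈ W, ∀ s t : Fin 5, μ s t = μ t s) (hWd : ∀ μ ∈ W, ∀ s : Fin 5, μ s s = 0)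
    (hWc : ∀ μ ∈ W, contractZ μ ∈ L3 U01 U02 U12) :
    Module.finrank ℂ W ≤ Module.finrank ℂ U01 + Module.finrank ℂ U02 + Module.finrank ℂ U12 := by
  by_cases h0 : Module.finrank ℂ U12 = 0
  · have hbot : U12 = ⊥ := Submodule.finrank_eq_zero.mp h0
    subst hbot
    have := captureIneqSym_of_third_bot U01 U02 W h01 h02 hWs hWd hWc
    omega
  have h := finrank_le_prolong_of_disjoint U01 U02 U12 W h01 h02 h12 hdis hd hWs hWd hWc
  have hXs : ∀ x ∈ U01 ⊔ U02, ∀ q r : Fin 5, x q r = x r q := by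
    intro x hx q r
    obtain ⟨y, hy, z, hz, rfl⟩ := Submodule.mem_sup.mp hx
    simp only [Pi.add_apply, h01 y hy q r, h02 z hz q r]
  have hX : Module.finrank ℂ ↥(U01 ⊔ U02) ≤ Module.finrank ℂ U01 + Module.finrank ℂ U02 :=
    Submodule.finrank_add_le_finrank_add_finrank U01 U02
  -- prolongation bounds `1 ↦ 1, 2 ↦ 2, 3 ↦ 4`
  by_cases hX0 : Module.finrank ℂ ↥(U01 ⊔ U02) = 0
  · have hbot : U01 ⊔ U02 = ⊥ := Submodule.finrank_eq_zero.mp hX0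
    rw [hbot, prolong_bot, finrank_bot] at h
    omega
  by_cases hX1 : Module.finrank ℂ ↥(U01 ⊔ U02) ≤ 1
  · have := finrank_prolong_le_one (U01 ⊔ U02) hXs hX1; omega
  by_cases hX2 : Module.finrank ℂ ↥(U01 ⊔ U02) ≤ 2
  · have := finrank_prolong_le_two (U01 ⊔ U02) hXs hX2; omega
  · have := finrank_prolong_le_four (U01 ⊔ U02) hXs (by omega); omega

end LaplaceFiveSeparatedCapture

end Summit.ValiantsHypothesis.ValiantsHypothesis.Theorems.RigidityForcesSymmetryRankRigidMinimalRepr
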